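import Mathlib.Data.ZMod.Basic
import Mathlib.Algebra.Ring.ULift
import Literature.AlgebraicGeometry.Motives.LinearCohomologyChangeOfRings
import Literature.AlgebraicGeometry.Motives.EllAdicTowerAlgebra
import Literature.AlgebraicGeometry.Motives.EtaleCohomologyPoint
import HarnessLib

/-!
# The `ℓ`-adic tower `(Hⁿ(X, ℤ/ℓᵐ))ₘ` of `R`-linear cohomology rings and its limit
# `Hⁿ(X, ℤ_ℓ) = lim_m Hⁿ(X, ℤ/ℓᵐ)` with its cup product (Milne V §1)

For a site `(C, J)` with a final object `T` and a prime `ℓ`, the levels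
`Hⁿ(X, ℤ/ℓᵐ) := Hⁿ_{ℤ/ℓᵐ}(X, (ℤ/ℓᵐ)_X)` (`LinearSheafCohomology.lean`, coefficients
`ZModPow ℓ m = ULift (ZMod (ℓ ^ m))`, each with its cup product) are connected by the reductions
`ρ_m : Hⁿ(X, ℤ/ℓᵐ⁺¹) → Hⁿ(X, ℤ/ℓᵐ)` of `LinearCohomologyChangeOfRings.lean` along
`ℤ/ℓᵐ⁺¹ ↠ ℤ/ℓᵐ` (kernel `(ℓᵐ)`, exact pair `(ℓᵐ, ℓ)`: `zmodPowRed`, `ker_zmodPowRed`,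
`ZModPow.exists_of_mul_pow_eq_zero`, `…_of_mul_eq_zero`), which are **ring homomorphisms**
(`zmodPowReduction_cup`, `zmodPowReduction_one`). Hence the inverse limit

  `ellAdicTowerCohomology hT ℓ n := lim_m Hⁿ(X, ℤ/ℓᵐ)` (the tree's `towerLim`)

inherits a cup product `lim Hⁱ × lim Hʲ → lim Hⁱ⁺ʲ` computed levelwise
(`ellAdicTowerCohomology.cup`), associative and unital (`cup_assoc`, `one_cup`, `cup_one`),
biadditive, and a `ℤ_ℓ`-module structure (`towerLim.instModulePadicInt` of
`EllAdicTowerAlgebra.lean`: level `m` is killed by `ℓᵐ`) for which the cup product is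
`ℤ_ℓ`-bilinear (`smul_cup`, `cup_smul`). Milne V §1 (p. 176): "`Hʳ(X, ℤ_l) = lim Hʳ(X, ℤ/lⁿ)` …
the ring `ℤ_l = lim ℤ/(lⁿ)` acts"; the cup products on `Hʳ(X, ℤ_l)` are the limits of those on the
finite levels (V §1, Lemma 1.11 ff.).

## References

* J. S. Milne, *Étale cohomology* (reissue 2025; held copy), V §1 pp. 175–177, III Ex. 2.25.
  [Milne2025]

## Design notes

* Generic in the site; the étale specialisation (last section) is `J = X.smallEtaleTopology`,
  `hT = isTerminalEtaleMkId X` (`EtaleCohomologyPoint.lean`): `etaleZModPowCohomology`,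
  `etaleEllAdicTowerCohomology`.
* `ZModPow ℓ m` is `ULift` of `ZMod (ℓ ^ m)` because the coefficient ring of `linearCohomology`
  must live in the universe of the site's hom-types (as Mathlib's `Sheaf.H` uses `ULift ℤ`).
-/

universe w u

open CategoryTheory CategoryTheory.Limits Opposite CategoryTheory.Abelian AlgebraicGeometry

noncomputable section

namespace Literature.AlgebraicGeometry.Motives

/-! ### The rings `ℤ/ℓᵐ` (lifted to universe `w`) and the reductions `ℤ/ℓᵐ⁺¹ ↠ ℤ/ℓᵐ` -/

section Rings

variable (ℓ : ℕ) [hℓ : Fact ℓ.Prime] (m : ℕ)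

/-- The coefficient ring `ℤ/ℓᵐ` in universe `w`. [folklore] -/
abbrev ZModPow : Type w := ULift.{w} (ZMod (ℓ ^ m))

/-- The reduction `ℤ/ℓᵐ⁺¹ → ℤ/ℓᵐ` (Mathlib `ZMod.castHom`, lifted). [folklore] -/
def zmodPowRed : ZModPow.{w} ℓ (m + 1) →+* ZModPow.{w} ℓ m :=
  ULift.ringEquiv.symm.toRingHom.comp
    ((ZMod.castHom (pow_dvd_pow ℓ m.le_succ) (ZMod (ℓ ^ m))).comp ULift.ringEquiv.toRingHom)

omit hℓ in
/-- The reduction is surjective. [folklore] -/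
theorem zmodPowRed_surjective : Function.Surjective (zmodPowRed.{w} ℓ m) := by
  rintro ⟨y⟩
  obtain ⟨x, hx⟩ := ZMod.ringHom_surjective (ZMod.castHom (pow_dvd_pow ℓ m.le_succ) (ZMod (ℓ ^ m))) y
  exact ⟨ULift.up x, ULift.ext _ _ hx⟩

omit hℓ in
/-- `ℓᵐ · ℓ = 0` in `ℤ/ℓᵐ⁺¹`. [folklore] -/
theorem ZModPow.pow_mul_self :
    (ULift.up ((ℓ ^ m : ℕ) : ZMod (ℓ ^ (m + 1))) : ZModPow.{w} ℓ (m + 1)) *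
      ULift.up (ℓ : ZMod (ℓ ^ (m + 1))) = 0 := by
  apply ULift.ext
  change ((ℓ ^ m : ℕ) : ZMod (ℓ ^ (m + 1))) * (ℓ : ZMod (ℓ ^ (m + 1))) = 0
  rw [← Nat.cast_mul, ← pow_succ, ZMod.natCast_self]

/-- In `ℤ/ℓᵐ⁺¹`: `ann(ℓᵐ) ⊆ (ℓ)`. [folklore] -/
theorem ZMod.exists_of_mul_pow_eq_zero (s : ZMod (ℓ ^ (m + 1)))
    (hs : s * ((ℓ ^ m : ℕ) : ZMod (ℓ ^ (m + 1))) = 0) :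
    ∃ t, s = t * (ℓ : ZMod (ℓ ^ (m + 1))) := by
  haveI : NeZero (ℓ ^ (m + 1)) := ⟨(pow_pos hℓ.out.pos _).ne'⟩
  have h1 : ((s.val * ℓ ^ m : ℕ) : ZMod (ℓ ^ (m + 1))) = 0 := by
    rw [Nat.cast_mul, ZMod.natCast_zmod_val, hs]
  rw [ZMod.natCast_eq_zero_iff] at h1
  have h2 : ℓ * ℓ ^ m ∣ s.val * ℓ ^ m := by rwa [← pow_succ']
  obtain ⟨t, ht⟩ := Nat.dvd_of_mul_dvd_mul_right (pow_pos hℓ.out.pos m) h2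
  exact ⟨t, by rw [← ZMod.natCast_zmod_val s, ht, Nat.cast_mul, mul_comm]⟩

/-- In `ℤ/ℓᵐ⁺¹`: `ann(ℓ) ⊆ (ℓᵐ)`. [folklore] -/
theorem ZMod.exists_of_mul_eq_zero (s : ZMod (ℓ ^ (m + 1)))
    (hs : s * (ℓ : ZMod (ℓ ^ (m + 1))) = 0) :
    ∃ t, s = t * ((ℓ ^ m : ℕ) : ZMod (ℓ ^ (m + 1))) := by
  haveI : NeZero (ℓ ^ (m + 1)) := ⟨(pow_pos hℓ.out.pos _).ne'⟩
  have h1 : ((s.val * ℓ : ℕ) : ZMod (ℓ ^ (m + 1))) = 0 := by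
    rw [Nat.cast_mul, ZMod.natCast_zmod_val, hs]
  rw [ZMod.natCast_eq_zero_iff] at h1
  have h2 : ℓ ^ m * ℓ ∣ s.val * ℓ := by rwa [← pow_succ]
  obtain ⟨t, ht⟩ := Nat.dvd_of_mul_dvd_mul_right hℓ.out.pos h2
  exact ⟨t, by rw [← ZMod.natCast_zmod_val s, ht, Nat.cast_mul, mul_comm]⟩

/-- The exact pair `(ℓᵐ, ℓ)` of `ZModPow ℓ (m+1)`: `ann(ℓᵐ) ⊆ (ℓ)`. [folklore] -/
theorem ZModPow.exists_of_mul_pow_eq_zero (s : ZModPow.{w} ℓ (m + 1))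
    (hs : s * ULift.up ((ℓ ^ m : ℕ) : ZMod (ℓ ^ (m + 1))) = 0) :
    ∃ t : ZModPow.{w} ℓ (m + 1), s = t * ULift.up (ℓ : ZMod (ℓ ^ (m + 1))) := by
  obtain ⟨t, ht⟩ := ZMod.exists_of_mul_pow_eq_zero ℓ m s.down (congrArg ULift.down hs)
  exact ⟨ULift.up t, ULift.ext _ _ ht⟩

/-- The exact pair `(ℓᵐ, ℓ)` of `ZModPow ℓ (m+1)`: `ann(ℓ) ⊆ (ℓᵐ)`. [folklore] -/
theorem ZModPow.exists_of_mul_eq_zero (s : ZModPow.{w} ℓ (m + 1))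
    (hs : s * ULift.up (ℓ : ZMod (ℓ ^ (m + 1))) = 0) :
    ∃ t : ZModPow.{w} ℓ (m + 1), s = t * ULift.up ((ℓ ^ m : ℕ) : ZMod (ℓ ^ (m + 1))) := by
  obtain ⟨t, ht⟩ := ZMod.exists_of_mul_eq_zero ℓ m s.down (congrArg ULift.down hs)
  exact ⟨ULift.up t, ULift.ext _ _ ht⟩

/-- `ker(ℤ/ℓᵐ⁺¹ → ℤ/ℓᵐ) = (ℓᵐ)`. [folklore] -/
theorem ZMod.ker_castHom_pow :
    RingHom.ker (ZMod.castHom (pow_dvd_pow ℓ m.le_succ) (ZMod (ℓ ^ m))) =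
      Ideal.span {((ℓ ^ m : ℕ) : ZMod (ℓ ^ (m + 1)))} := by
  haveI : NeZero (ℓ ^ (m + 1)) := ⟨(pow_pos hℓ.out.pos _).ne'⟩
  haveI : NeZero (ℓ ^ m) := ⟨(pow_pos hℓ.out.pos _).ne'⟩
  ext x
  rw [RingHom.mem_ker, Ideal.mem_span_singleton']
  constructor
  · intro hx
    have h1 : ((x.val : ℕ) : ZMod (ℓ ^ m)) = 0 := by
      rw [← hx, ZMod.castHom_apply, ZMod.cast_eq_val]
    rw [ZMod.natCast_eq_zero_iff] at h1
    obtain ⟨t, ht⟩ := h1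
    exact ⟨t, by rw [← ZMod.natCast_zmod_val x, ht, Nat.cast_mul, mul_comm]⟩
  · rintro ⟨t, rfl⟩
    rw [map_mul, map_natCast, ZMod.natCast_self, mul_zero]

/-- **`ker(zmodPowRed) = (ℓᵐ)`** in `ZModPow ℓ (m+1)`. [folklore] -/
theorem ker_zmodPowRed : RingHom.ker (zmodPowRed.{w} ℓ m) =
    Ideal.span {(ULift.up ((ℓ ^ m : ℕ) : ZMod (ℓ ^ (m + 1))) : ZModPow.{w} ℓ (m + 1))} := by
  ext ⟨x⟩
  rw [RingHom.mem_ker, Ideal.mem_span_singleton']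
  have hk : x ∈ RingHom.ker (ZMod.castHom (pow_dvd_pow ℓ m.le_succ) (ZMod (ℓ ^ m))) ↔
      ∃ t, t * ((ℓ ^ m : ℕ) : ZMod (ℓ ^ (m + 1))) = x := by
    rw [ZMod.ker_castHom_pow ℓ m, Ideal.mem_span_singleton']
  constructor
  · intro h
    obtain ⟨t, ht⟩ := hk.1 (congrArg ULift.down h)
    exact ⟨ULift.up t, congrArg ULift.up ht⟩
  · rintro ⟨⟨t⟩, ht⟩
    have : ZMod.castHom (pow_dvd_pow ℓ m.le_succ) (ZMod (ℓ ^ m)) x = 0 :=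
      hk.2 ⟨t, congrArg ULift.down ht⟩
    exact congrArg ULift.up this

end Rings

/-! ### The levels `Hⁿ(X, ℤ/ℓᵐ)` and the ring homomorphisms `ρ_m : Hⁿ(X, ℤ/ℓᵐ⁺¹) → Hⁿ(X, ℤ/ℓᵐ)` -/

section Levels

variable {C : Type u} [Category.{w} C] {J : GrothendieckTopology C} {T : C} (hT : IsTerminal T)
variable (ℓ : ℕ) [Fact ℓ.Prime]
variable [∀ m, HasSheafify J (ModuleCat.{w} (ZModPow.{w} ℓ m))]
  [∀ m, IsGrothendieckAbelian.{w} (Sheaf J (ModuleCat.{w} (ZModPow.{w} ℓ m)))]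

/-- **The level `Hⁿ(X, ℤ/ℓᵐ)`** of the `ℓ`-adic tower: the `ℤ/ℓᵐ`-linear cohomology of the
constant sheaf `ℤ/ℓᵐ` (`linearCohomology`, with its cup product). [cite: Milne2025, V §1 (p. 175)] -/
abbrev zmodPowCohomology (m n : ℕ) : Type w :=
  linearCohomology (J := J) (ZModPow.{w} ℓ m) (constantSheafSelf J (ZModPow.{w} ℓ m)) n

/-- **The reduction `ρ_m : Hⁿ(X, ℤ/ℓᵐ⁺¹) → Hⁿ(X, ℤ/ℓᵐ)`** (change of coefficients followed by
the change-of-rings bijection of `LinearCohomologyChangeOfRings.lean`). [cite: Milne2025, III Exercise 2.25] -/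
def zmodPowReduction (m n : ℕ) :
    zmodPowCohomology (J := J) ℓ (m + 1) n →+ zmodPowCohomology (J := J) ℓ m n :=
  reductionMap (zmodPowRed.{w} ℓ m) hT (zmodPowRed_surjective ℓ m) (ker_zmodPowRed ℓ m)
    (ZModPow.pow_mul_self ℓ m) (ZModPow.exists_of_mul_pow_eq_zero ℓ m)
    (ZModPow.exists_of_mul_eq_zero ℓ m) n

/-- **`ρ_m` is multiplicative**: `ρ(x ∪ x′) = ρ(x) ∪ ρ(x′)`. [folklore] -/
theorem zmodPowReduction_cup (m : ℕ) {i j n : ℕ} (h : i + j = n)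
    (x : zmodPowCohomology (J := J) ℓ (m + 1) i) (x' : zmodPowCohomology (J := J) ℓ (m + 1) j) :
    zmodPowReduction hT ℓ m n (linearCohomology.cup h x x') =
      linearCohomology.cup h (zmodPowReduction hT ℓ m i x) (zmodPowReduction hT ℓ m j x') :=
  reductionMap_cup _ hT _ _ _ _ _ h x x'

/-- **`ρ_m(1) = 1`.** [folklore] -/
theorem zmodPowReduction_one (m : ℕ) :
    zmodPowReduction hT ℓ m 0 (linearCohomology.one J (ZModPow.{w} ℓ (m + 1))) =
      linearCohomology.one J (ZModPow.{w} ℓ m) :=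
  reductionMap_one _ hT _ _ _ _ _

end Levels

/-! ### The limit `lim_m Hⁿ(X, ℤ/ℓᵐ)` with its cup product and `ℤ_ℓ`-module structure -/

section Limit

variable {C : Type u} [Category.{w} C] {J : GrothendieckTopology C} {T : C} (hT : IsTerminal T)
variable (ℓ : ℕ) [Fact ℓ.Prime]
variable [∀ m, HasSheafify J (ModuleCat.{w} (ZModPow.{w} ℓ m))]
  [∀ m, IsGrothendieckAbelian.{w} (Sheaf J (ModuleCat.{w} (ZModPow.{w} ℓ m)))]

/-- **`lim_m Hⁿ(X, ℤ/ℓᵐ)`**, the `ℓ`-adic cohomology in degree `n` as the inverse limit of the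
tower along the reductions `ρ_m` (the tree's `towerLim`; Milne V §1: `Hʳ(X, ℤ_l) = lim Hʳ(X, ℤ/lⁿ)`).
[cite: Milne2025, V §1 (p. 176)] -/
abbrev ellAdicTowerCohomology (n : ℕ) : AddSubgroup (∀ m, zmodPowCohomology (J := J) ℓ m n) :=
  towerLim (fun m => zmodPowReduction hT ℓ m n)

namespace ellAdicTowerCohomology

variable {hT ℓ}

/-- **The cup product on `lim_m Hⁿ(X, ℤ/ℓᵐ)`**, computed levelwise: `(x ∪ y)_m = x_m ∪ y_m`
(compatible with the transition maps since the `ρ_m` are ring homomorphisms). [cite: Milne2025, V §1 (p. 176)] -/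
def cup {i j n : ℕ} (h : i + j = n) (x : ellAdicTowerCohomology (J := J) hT ℓ i)
    (y : ellAdicTowerCohomology (J := J) hT ℓ j) : ellAdicTowerCohomology (J := J) hT ℓ n :=
  ⟨fun m => linearCohomology.cup h (x.1 m) (y.1 m),
    (mem_towerLim_iff _).2 fun m => by
      rw [zmodPowReduction_cup, (mem_towerLim_iff _).1 x.2 m, (mem_towerLim_iff _).1 y.2 m]⟩

/-- Components of the cup product. [folklore] -/
@[simp]
theorem coe_cup {i j n : ℕ} (h : i + j = n) (x : ellAdicTowerCohomology (J := J) hT ℓ i)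
    (y : ellAdicTowerCohomology (J := J) hT ℓ j) (m : ℕ) :
    (cup h x y).1 m = linearCohomology.cup h (x.1 m) (y.1 m) :=
  rfl

variable (hT ℓ) in
/-- **The unit `1 ∈ lim_m H⁰(X, ℤ/ℓᵐ)`** (the compatible family of units). [folklore] -/
def one : ellAdicTowerCohomology (J := J) hT ℓ 0 :=
  ⟨fun m => linearCohomology.one J (ZModPow.{w} ℓ m),
    (mem_towerLim_iff _).2 fun m => zmodPowReduction_one hT ℓ m⟩

/-- Components of the unit. [folklore] -/
@[simp]
theorem coe_one (m : ℕ) : (one hT ℓ).1 m = linearCohomology.one J (ZModPow.{w} ℓ m) :=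
  rfl

/-- `1 ∪ y = y`. [folklore] -/
theorem one_cup {j : ℕ} (y : ellAdicTowerCohomology (J := J) hT ℓ j) :
    cup (zero_add j) (one hT ℓ) y = y :=
  Subtype.ext <| funext fun m => by rw [coe_cup, coe_one, linearCohomology.one_cup]

/-- `x ∪ 1 = x`. [folklore] -/
theorem cup_one {i : ℕ} (x : ellAdicTowerCohomology (J := J) hT ℓ i) :
    cup (add_zero i) x (one hT ℓ) = x :=
  Subtype.ext <| funext fun m => by rw [coe_cup, coe_one, linearCohomology.cup_one]

/-- **Associativity** of the cup product on the limit (levelwise `cup_assoc`). [folklore] -/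
theorem cup_assoc {i j l ij jl n : ℕ} (hij : i + j = ij) (hjl : j + l = jl) (h₁ : ij + l = n)
    (h₂ : i + jl = n) (a : ellAdicTowerCohomology (J := J) hT ℓ i)
    (b : ellAdicTowerCohomology (J := J) hT ℓ j) (c : ellAdicTowerCohomology (J := J) hT ℓ l) :
    cup h₁ (cup hij a b) c = cup h₂ a (cup hjl b c) :=
  Subtype.ext <| funext fun m => by
    simp only [coe_cup]
    exact linearCohomology.cup_assoc hij hjl h₁ h₂ _ _ _

/-- The cup product is additive in the left variable. [folklore] -/
theorem add_cup {i j n : ℕ} (h : i + j = n) (x x' : ellAdicTowerCohomology (J := J) hT ℓ i)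
    (y : ellAdicTowerCohomology (J := J) hT ℓ j) : cup h (x + x') y = cup h x y + cup h x' y :=
  Subtype.ext <| funext fun m => by
    simp only [coe_cup, AddSubgroup.coe_add, Pi.add_apply, map_add, LinearMap.add_apply]

/-- The cup product is additive in the right variable. [folklore] -/
theorem cup_add {i j n : ℕ} (h : i + j = n) (x : ellAdicTowerCohomology (J := J) hT ℓ i)
    (y y' : ellAdicTowerCohomology (J := J) hT ℓ j) : cup h x (y + y') = cup h x y + cup h x y' :=
  Subtype.ext <| funext fun m => by
    simp only [coe_cup, AddSubgroup.coe_add, Pi.add_apply, map_add]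

/-- Level `m` of the tower is killed by `ℓᵐ` (it is a `ℤ/ℓᵐ`-module), the hypothesis of the
`ℤ_ℓ`-module structure `towerLim.instModulePadicInt`. [folklore] -/
instance fact_pow_smul_eq_zero (n : ℕ) :
    Fact (∀ m (a : zmodPowCohomology (J := J) ℓ m n), ℓ ^ m • a = 0) :=
  ⟨fun m a => by
    rw [← Nat.cast_smul_eq_nsmul (ZModPow.{w} ℓ m)]
    have : ((ℓ ^ m : ℕ) : ZModPow.{w} ℓ m) = 0 := by
      apply ULift.ext
      change ((ℓ ^ m : ℕ) : ZMod (ℓ ^ m)) = 0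
      exact ZMod.natCast_self _
    rw [this, zero_smul]⟩

/-- **`lim_m Hⁿ(X, ℤ/ℓᵐ)` is a `ℤ_ℓ`-module** (`(x • a)_m = (x mod ℓᵐ) a_m`; Milne V §1: "the ring
`ℤ_l = lim ℤ/(lⁿ)` acts"). [cite: Milne2025, V §1 (p. 176)] -/
instance instModule (n : ℕ) : Module ℤ_[ℓ] (ellAdicTowerCohomology (J := J) hT ℓ n) :=
  towerLim.instModulePadicInt _ ℓ

/-- The cup product is `ℤ_ℓ`-linear in the left variable. [folklore] -/
theorem smul_cup {i j n : ℕ} (h : i + j = n) (r : ℤ_[ℓ])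
    (x : ellAdicTowerCohomology (J := J) hT ℓ i) (y : ellAdicTowerCohomology (J := J) hT ℓ j) :
    cup h (r • x) y = r • cup h x y :=
  Subtype.ext <| funext fun m => by
    simp only [coe_cup, towerLim.coe_smul_apply, map_nsmul, LinearMap.smul_apply]

/-- The cup product is `ℤ_ℓ`-linear in the right variable. [folklore] -/
theorem cup_smul {i j n : ℕ} (h : i + j = n) (r : ℤ_[ℓ])
    (x : ellAdicTowerCohomology (J := J) hT ℓ i) (y : ellAdicTowerCohomology (J := J) hT ℓ j) :
    cup h x (r • y) = r • cup h x y :=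
  Subtype.ext <| funext fun m => by
    simp only [coe_cup, towerLim.coe_smul_apply, map_nsmul]

/-- **The cup product on `lim_m Hⁿ(X, ℤ/ℓᵐ)` as a `ℤ_ℓ`-bilinear map.** [cite: Milne2025, V §1 (p. 176)] -/
def cupBilin {i j n : ℕ} (h : i + j = n) :
    ellAdicTowerCohomology (J := J) hT ℓ i →ₗ[ℤ_[ℓ]] ellAdicTowerCohomology (J := J) hT ℓ j →ₗ[ℤ_[ℓ]]
      ellAdicTowerCohomology (J := J) hT ℓ n :=
  LinearMap.mk₂ ℤ_[ℓ] (cup h) (add_cup h) (smul_cup h) (cup_add h) (cup_smul h)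

/-- `cupBilin h x y = cup h x y`. [folklore] -/
@[simp]
theorem cupBilin_apply {i j n : ℕ} (h : i + j = n) (x : ellAdicTowerCohomology (J := J) hT ℓ i)
    (y : ellAdicTowerCohomology (J := J) hT ℓ j) : cupBilin h x y = cup h x y :=
  rfl

end ellAdicTowerCohomology

end Limit

/-! ### The étale specialisation: `Hⁿ(X_ét, ℤ/ℓᵐ)` and `lim_m Hⁿ(X_ét, ℤ/ℓᵐ)` for a scheme `X` -/

section Etale

variable (X : Scheme.{u}) (ℓ : ℕ) [Fact ℓ.Prime]

set_option synthInstance.maxHeartbeats 200000 in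
/-- Sheafification for `ℤ/ℓᵐ`-module presheaves on `X_et` (Mathlib, recorded levelwise so that the
`∀ m` instance arguments of the generic constructions are found at once). [folklore] -/
instance hasSheafify_zmodPow (m : ℕ) :
    HasSheafify X.smallEtaleTopology (ModuleCat.{u} (ZModPow.{u} ℓ m)) :=
  inferInstance

set_option synthInstance.maxHeartbeats 200000 in
/-- `Sh(X_et, ℤ/ℓᵐ)` is Grothendieck abelian (Mathlib `isGrothendieckAbelian_sheaf_smallEtaleTopology`,
recorded levelwise). [folklore] -/
instance isGrothendieckAbelian_sheaf_zmodPow (m : ℕ) :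
    IsGrothendieckAbelian.{u} (Sheaf X.smallEtaleTopology (ModuleCat.{u} (ZModPow.{u} ℓ m))) :=
  inferInstance

/-- **`Hⁿ(X_ét, ℤ/ℓᵐ)`** with its cup product: the level `m` of the `ℓ`-adic tower on Mathlib's
small étale site of `X` (equal to `etaleModCohomology X (ZModPow ℓ m) n`). The instances
`HasSheafify`, `IsGrothendieckAbelian` are Mathlib's (`AffineEtale.lean`). [cite: Milne2025, V §1 (p. 175)] -/
abbrev etaleZModPowCohomology (m n : ℕ) : Type u :=
  zmodPowCohomology.{u, u + 1} (J := X.smallEtaleTopology) ℓ m n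

omit [Fact ℓ.Prime] in
/-- The level `Hⁿ(X_ét, ℤ/ℓᵐ)` is literally the `ℤ/ℓᵐ`-linear étale cohomology of
`LinearSheafCohomology.lean`. [folklore] -/
theorem etaleZModPowCohomology_eq (m n : ℕ) :
    etaleZModPowCohomology X ℓ m n = etaleModCohomology X (ZModPow.{u} ℓ m) n :=
  rfl

/-- **`lim_m Hⁿ(X_ét, ℤ/ℓᵐ)`** with its cup product and `ℤ_ℓ`-module structure: the `ℓ`-adic étale
cohomology of `X` in degree `n` as an inverse limit of the `R`-linear levels, the final object of
`X_et` being `X` itself (`isTerminalEtaleMkId`). Milne V §1: `Hʳ(X, ℤ_l) = lim Hʳ(X, ℤ/lⁿ)`.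
[cite: Milne2025, V §1 (p. 176)] -/
abbrev etaleEllAdicTowerCohomology (n : ℕ) :
    AddSubgroup (∀ m, etaleZModPowCohomology X ℓ m n) :=
  ellAdicTowerCohomology.{u, u + 1} (J := X.smallEtaleTopology) (isTerminalEtaleMkId X) ℓ n

/-- The cup product of `lim_m H•(X_ét, ℤ/ℓᵐ)` is unital (an instance of
`ellAdicTowerCohomology.one_cup`, recorded to fix the specialisation). [folklore] -/
theorem etaleEllAdicTowerCohomology.one_cup {j : ℕ} (y : etaleEllAdicTowerCohomology X ℓ j) :
    ellAdicTowerCohomology.cup (zero_add j) (ellAdicTowerCohomology.one (isTerminalEtaleMkId X) ℓ) y =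
      y :=
  ellAdicTowerCohomology.one_cup y

end Etale

end Literature.AlgebraicGeometry.Motives
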